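/-
Copyright (c) 2026 the pub-hodgecm-mathlib formalisation cell (harness21).  Prover seat hodgecm-mathlib-LH7-p05 (g0), req620 Track A «(D-RAM) FOUR-FRAME» squad, helper lane on
h413 = stmt-HodgeConjecture-24833 (count-neutral).  β-BOARD v1 row R7 «GLUE CLASSES» — THEOREM C «THE FOOT WINDOW» (SIG-R7-GlueClasses v1 §2∕§3, «=» LH4-p05 (g8)
15:17:42Z, F0P3a-p01 (g37) 15:18:34Z), FILE ASM-2.  2026-09-04.
-/
import Summits.HodgeConjecture.HodgeConjecture.Theorems.F0P3cDyRamLabelledOddGlueWindowCut          -- ASM-1 (this seat): `stable_and_shell_latt_glued_rep_iff_of_near`, `v_div_sub_div_le`, `isNormalisedLattice_latt_glued_rep`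
import Summits.HodgeConjecture.HodgeConjecture.Theorems.F0P3cDyRamLabelledOddGlueWindowSigns        -- ASM-1b (this seat): `classSign_mul_labelSign_eq`, `exists_normClass_system`
import Summits.HodgeConjecture.HodgeConjecture.Theorems.F0P3cDyRamLabelledOddGluedRepClassSumHead  -- ★ p861678 (this seat): HEAD `labelledOddCount_div_relIndex_glued_rep_eq`
import Summits.HodgeConjecture.HodgeConjecture.Theorems.F0P3cDyRamLabelledOddGluedDecomposition    -- ★ p861389 (this seat): `finsum_labelledOdd_div_relIndex_glued_sep_eq`
import Summits.HodgeConjecture.HodgeConjecture.Theorems.F0P3cDyRamGlueWindowVanishing              -- ★ p861670 (LH7-p07 (g0)): the three window sums `sum_filter_sum_normSign_*_eq_zero`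
import Summits.HodgeConjecture.HodgeConjecture.Theorems.F0P3cDyRamTowerSignTokenSharp              -- ★ p861295 (LH7-p07 (g0)): `exists_towerSign_prec_abs_of_le`
import Summits.HodgeConjecture.HodgeConjecture.Theorems.F0P3cDyRamDiagonalGluedStabiliserIndex     -- ★ (iv-b) (LH4-p08 (g2)): `stabiliserWeight_latt_glued_eq`
import Summits.HodgeConjecture.HodgeConjecture.Theorems.F0P3cDyRamElementDatumParity               -- ★ (LH4-p11): `depth_mod_two_eq_of_isElementDatum`
import Summits.HodgeConjecture.HodgeConjecture.Theorems.F0P3cDyRamLabelledOddPureStrataG1          -- ★ p860827 (LH4-p11 (g8)): DEFS of record; brings ★ `stratum_G1_eq`, `stratum_G1_eq_empty_of_odd`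
import Literature.NumberTheory.LocalFields.WildQuadraticDatumTraceBound                            -- ★ `trace_bound_of_isRamifiedQuadraticDatum`
import HarnessLib

/-!
# Crux `H413`, line LH4 «(D-RAM) FOUR-FRAME» — (β) Stage B, β-BOARD row R7 «GLUE CLASSES», THEOREM C: ON THE FOOT WINDOW `n₁ = n₂ + s`, `n₂ ≤ 2ρ + ℓ₀`, `2ρ + mc ≤ 2n₂`
# THE CLEAN-SHELL CUT OF THE GLUED STRATUM `G₁ = (2ρ, 2ρ+s, 2ρ+s)` CARRIES LABELLED ODD VALUE `0` — `Σᶠ_{M ∈ G₁ ∩ shell} lOC_i(M) ∕ [𝒰 : N(S̃′(M))] = 0`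

Cell `hodgecm-mathlib` (D-0151), FLOOR 0, crux item H413 = `stmt-HodgeConjecture-24833`, route `HCCMUnconditional`; squad F0∕P3c∕LH4 (β-table fan, sub-dealer LH4-p05 (g8)).
THEOREMS ONLY (no `def`, no instance, no notation, no `sorry`, default heartbeats); ★-only imports; lane `--supports stmt-HodgeConjecture-24833 --as helper` (count-neutral);
pays NO row, states NO law.  Consumer: F0P3a-p01 (g37)'s hRest dispatcher `restValue_G1_of_rows` (binder `hC`), with ★ p861363's empty-cut heads (`hA`, `hB`) — together
they give the rest value `0` of every glued stratum off the tube read (β-BOARD v1 row R7).  Binders in ★ p860827's COMMON SHAPE (tower 1), class `[CompleteSpace K] [Fintype 𝓀[K]]`.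

THE PROOF (SIG-R7-GlueClasses v1 §3, ROADMAP-R7-TheoremC v1).  `s` odd: the stratum is empty (★ `stratum_G1_eq_empty_of_odd`).  `s = 2t′`: ★ `stratum_G1_eq` makes the stratum the
glued family; ★ p861389 decomposes the cut sum over the `σ`-fixed class representatives `g ∈ R` (★ (iv-c)) as `C · Σ_{g ∈ R, latt V(1,1,g) stable ∧ on the shell} lOC_i ∕ [𝒰 : N]`;
ASM-1 turns that filter into the `g`-shell `|g + c₀| = |ϖ|^{2t′+E}` (`E = 2ρ + ℓ₀ − n₂`, `c₀ = g_β∕g_α` the ratio of LH7-p07's sharp tokens ★ p861295, `|c₀ − (β−1)∕(α−1)| ≤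
|ϖ|^{2t′+E+1}` by ASM-1 `v_div_sub_div_le`); per representative ★ p861678 evaluates `lOC_i ∕ [𝒰 : N] = ω(D_i)·w ∕ (2·#Aβ·#Aγ) · Σ_{aβ, aγ} ω(class_i)·ω(L)` over norm-class systems
`Aβ, Aγ` (ASM-1b `exists_normClass_system`), the weight `w` being the constant ★ `stabiliserWeight_latt_glued_eq`; ASM-1b `classSign_mul_labelSign_eq` rewrites each summand as
`ω(g_α)·G_i(g + (1+g)(aβ − 1))` (`aγ`-blind), and LH7-p07's ★ p861670 `sum_filter_sum_normSign_{mul_add, add, one_add_mul_add}_eq_zero` kills `Σ_{g} Σ_{aβ} G_i`.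
HONEST LABEL: count-neutral; with ★ p861363 this closes β-BOARD row R7's value; hRest ∕ (β-BAL) ∕ (β) ∕ T₊ OPEN; `HC_CM` is proved only modulo the 7 printed citations (2 remaining
named inputs: hLiu418 = `stmt-HodgeConjecture-24832`, h413 = `stmt-HodgeConjecture-24833`) until rung 0 closes.
References: [Kottwitz1986BaseChangeUnits] §1 pp. 240–241 · [Rogawski1990] §4.9 Prop. 4.9.1 (a)(b) p. 55, §4.10 p. 58 · [LanglandsShelstad1987] §3 · [Serre1979] Ch. V §3, Ch. XV §2 ·
[Serre1980Trees] Ch. II §1.1.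
-/

set_option autoImplicit false

noncomputable section

namespace Summit.HodgeConjecture.HodgeConjecture.Cruxes.H413.F0P3cDyRamLabelledOddGlueWindow

open Matrix WithZero
open Literature.NumberTheory.Automorphic Literature.NumberTheory.Automorphic.HermitianLattice Literature.NumberTheory.Automorphic.UnitaryGroup
open Literature.NumberTheory.Automorphic.UnitaryLatticeTree Literature.NumberTheory.Automorphic.UnitaryThreeFourFrame
open Literature.NumberTheory.LocalFields Literature.NumberTheory.LocalFields.WildQuadraticDatum
open Summit.HodgeConjecture.HodgeConjecture.Cruxes.H413.F0P3cDyRamFourFramePieces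
open Summit.HodgeConjecture.HodgeConjecture.Cruxes.H413.F0P3cDyRamFourFrameCensusDefs
open Summit.HodgeConjecture.HodgeConjecture.Cruxes.H413.F0P3cDyRamStageOneBDefs (mcOfRecord)
open Summit.HodgeConjecture.HodgeConjecture.Cruxes.H413.F0P3cDyRamDiagonalTorusDefs
open Summit.HodgeConjecture.HodgeConjecture.Cruxes.H413.F0P3cDyRamDiagonalStrataDefs
open Summit.HodgeConjecture.HodgeConjecture.Cruxes.H413.F0P3cDyRamLabelledOddCountDefs
open Summit.HodgeConjecture.HodgeConjecture.Cruxes.H413.F0P3cDyRamDiagonalGluedStratum (stratum_G1_eq stratum_G1_eq_empty_of_odd)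
open Summit.HodgeConjecture.HodgeConjecture.Cruxes.H413.F0P3cDyRamDiagonalGluedClassRepresentatives (exists_fixed_class_representatives v_mul_map_pow map_mul_map_eq)
open Summit.HodgeConjecture.HodgeConjecture.Cruxes.H413.F0P3cDyRamDiagonalGluedTorusOrbits (exists_gl_coe_eq_glued)
open Summit.HodgeConjecture.HodgeConjecture.Cruxes.H413.F0P3cDyRamDiagonalGluedStabiliserIndex (stabiliserWeight_latt_glued_eq)
open Summit.HodgeConjecture.HodgeConjecture.Cruxes.H413.F0P3cDyRamLevelCountDiagonalModel (latticeInLevel_diagonal_mapGL_iff)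
open Summit.HodgeConjecture.HodgeConjecture.Cruxes.H413.F0P3cDyRamValueClassLabelEquivariant (isTorusEquivariantLabel_valueClassLabel)
open Summit.HodgeConjecture.HodgeConjecture.Cruxes.H413.F0P3cDyRamElementDatumParity (depth_mod_two_eq_of_isElementDatum)
open Summit.HodgeConjecture.HodgeConjecture.Cruxes.H413.F0P3cDyRamTowerSignTokenSharp (exists_towerSign_prec_abs_of_le)
open Summit.HodgeConjecture.HodgeConjecture.Cruxes.H413.F0P3cDyRamLabelledOddGluedDecomposition (finsum_labelledOdd_div_relIndex_glued_sep_eq)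
open Summit.HodgeConjecture.HodgeConjecture.Cruxes.H413.F0P3cDyRamLabelledOddGluedRepClassSumHead (labelledOddCount_div_relIndex_glued_rep_eq)
open Summit.HodgeConjecture.HodgeConjecture.Cruxes.H413.F0P3cDyRamLabelledOddGlueWindowCut (stable_and_shell_latt_glued_rep_iff_of_near v_div_sub_div_le isNormalisedLattice_latt_glued_rep)
open Summit.HodgeConjecture.HodgeConjecture.Cruxes.H413.F0P3cDyRamLabelledOddGlueWindowSigns (classSign_mul_labelSign_eq exists_normClass_system)
open Summit.HodgeConjecture.HodgeConjecture.Cruxes.H413.F0P3cDyRamGlueWindowVanishing (sum_filter_sum_normSign_add_eq_zero sum_filter_sum_normSign_mul_add_eq_zero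
  sum_filter_sum_normSign_one_add_mul_add_eq_zero)
open scoped Valued WithZero Matrix MatrixGroups

variable {K : Type} [Field K] [Valued K ℤᵐ⁰] [CompleteSpace K] [Fintype 𝓀[K]] {σ : K →+* K} {ϖ : K} {d t : ℕ} {α β : K} {N₀ n₁ n₂ n₃ : ℕ}

/-- **R7 THEOREM C, ON THE FOOT WINDOW: `G₁` CARRIES LABELLED ODD VALUE `0`** (`n₁ = n₂ + s`, `n₂ ≤ 2ρ + ℓ₀`, `2ρ + mcOfRecord d ≤ 2·n₂`; non-empty cut, the value vanishes by the
sign cancellation of the linearised class sums).  Binders ★ p860827's COMMON SHAPE, tower 1; with ★ p861363's `…_of_foot_tube` ∕ `…_of_foot_top` ∕ `…_of_offFoot_glue` every glued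
stratum off the tube read has rest value `0`. [cite: Kottwitz1986BaseChangeUnits, §1 pp. 240–241] [cite: Rogawski1990, §4.9 Prop. 4.9.1 (a)(b) p. 55] [cite: LanglandsShelstad1987, §3] -/
theorem finsum_stratum_G1_shell_labelledOdd_div_relIndex_eq_zero_of_foot_window (hD : IsRamifiedQuadraticDatum σ ϖ d t) (h2 : Valued.v (2 : K) < 1) (h2d : 2 ≤ d)
    (hE : IsElementDatum σ ϖ N₀ α β n₁ n₂ n₃) (hN₀ : d ≤ N₀) (hmc : mcOfRecord d ≤ N₀)
    (T : GL (Fin 3) K) (hT : (T : Matrix (Fin 3) (Fin 3) K) = Matrix.diagonal ![α, β, 1]) (ρ s : ℕ) (hρ : 1 ≤ ρ) (hs : 1 ≤ s)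
    (hfoot : n₁ = n₂ + s) (hlo : n₂ ≤ 2 * ρ + d % 2) (hhi : 2 * ρ + mcOfRecord d ≤ 2 * n₂) (i : Fin 3) :
    ∑ᶠ M ∈ {M : Submodule 𝒪[K] (Fin 3 → K) | M ∈ stratum σ ϖ T ![2 * ρ, 2 * ρ + s, 2 * ρ + s] ∧
        (LatticeInLevel ϖ (d % 2) (Matrix.diagonal ![α - 1, β - 1, 0]) M ∧ ¬ LatticeInLevel ϖ (d % 2 + 1) (Matrix.diagonal ![α - 1, β - 1, 0]) M ∧
          LatticeInLevel ϖ (mcOfRecord d) (Matrix.diagonal ![(α - 1) * (α - 1), (β - 1) * (β - 1), 0]) M)},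
      (labelledOddCount σ ϖ 0 i (valueClassLabel σ ϖ (α - 1) (β - 1) (mstarOfRecord d) d) M : ℚ) /
        ((((unitStabilizer M).map (unitNormMap σ 3)).relIndex (fixedUnitTorus σ 3) : ℕ) : ℚ) = 0 := by
  classical
  have hD' := hD
  obtain ⟨hσ, hvσ, hϖ, hfix, hd, -, -⟩ := hD'
  have hϖ0 : ϖ ≠ 0 := fun h0 => by rw [h0, map_zero] at hϖ; exact WithZero.coe_ne_zero hϖ.symm
  have hvϖ : Valued.v ϖ ≠ 0 := (Valuation.ne_zero_iff _).2 hϖ0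
  have hϖ1 : Valued.v ϖ < 1 := by rw [hϖ, ← exp_zero, exp_lt_exp]; norm_num
  have hpw : ∀ a b : ℕ, Valued.v ϖ ^ a ≤ Valued.v ϖ ^ b ↔ b ≤ a := fun a b => by
    rw [v_varpi_pow hϖ, v_varpi_pow hϖ, exp_le_exp]; omega
  -- ODD `s`: the stratum is empty
  rcases Nat.even_or_odd s with ⟨t', ht'⟩ | hodd
  swap
  · have hempty : {M : Submodule 𝒪[K] (Fin 3 → K) | M ∈ stratum σ ϖ T ![2 * ρ, 2 * ρ + s, 2 * ρ + s] ∧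
        (LatticeInLevel ϖ (d % 2) (Matrix.diagonal ![α - 1, β - 1, 0]) M ∧ ¬ LatticeInLevel ϖ (d % 2 + 1) (Matrix.diagonal ![α - 1, β - 1, 0]) M ∧
          LatticeInLevel ϖ (mcOfRecord d) (Matrix.diagonal ![(α - 1) * (α - 1), (β - 1) * (β - 1), 0]) M)} = ∅ := by
      rw [stratum_G1_eq_empty_of_odd hvσ hfix hϖ T hρ (by rintro ⟨k, hk⟩; obtain ⟨j, hj⟩ := hodd; omega)]
      exact Set.eq_empty_of_forall_notMem fun M hM => hM.1
    rw [hempty, finsum_mem_empty]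
  obtain rfl : s = 2 * t' := by omega
  have ht'1 : 1 ≤ t' := by omega
  -- numerology of record
  have hmcdef : mcOfRecord d = 2 * ((d % 2 + 2 * d - 1 + d) / 2) := rfl
  have hpar : n₂ % 2 = d % 2 := (depth_mod_two_eq_of_isElementDatum hD hE hN₀).2.1
  obtain ⟨E, hEdef⟩ : ∃ E, 2 * ρ + d % 2 = n₂ + E := ⟨2 * ρ + d % 2 - n₂, by omega⟩
  have hEρ : E < ρ := by omega
  have hEeven : E % 2 = 0 := by omega
  have hdeep : 2 * d - 1 + E ≤ 2 * ρ := by omega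
  have hn₂ : N₀ ≤ n₂ := hE.2.2.2.2.2.2.2.2.2.1
  have hα : Valued.v (α - 1) = Valued.v ϖ ^ n₂ := hE.2.2.2.2.2.2.1
  have hβ : Valued.v (β - 1) = Valued.v ϖ ^ (n₂ + 2 * t') := by have h := hE.2.2.2.2.2.1; rwa [hfoot] at h
  -- THE GLUED FAMILY, ITS CLASS REPRESENTATIVES AND REFERENCE FRAMES
  obtain ⟨R₀, hR₀fin, -, hR1, hR2, hR3⟩ := exists_fixed_class_representatives hσ hvσ hfix hϖ hd ρ t' hρ
  set R : Finset K := hR₀fin.toFinset with hRdef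
  have hmemR : ∀ g, g ∈ R ↔ g ∈ R₀ := fun g => Set.Finite.mem_toFinset hR₀fin
  have hR1' : ∀ g ∈ R, σ g = g ∧ Valued.v g = Valued.v ϖ ^ (2 * t') := fun g hg => hR1 g ((hmemR g).1 hg)
  have hR2' : ∀ f : K, σ f = f → Valued.v f = Valued.v ϖ ^ (2 * t') → ∃ g ∈ R, Valued.v (f - g) ≤ Valued.v ϖ ^ (ρ + 2 * t') :=
    fun f hσf hvf => by obtain ⟨g, hg, h⟩ := hR2 f hσf hvf; exact ⟨g, (hmemR g).2 hg, h⟩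
  have hR3' : ∀ g ∈ R, ∀ g' ∈ R, Valued.v (g - g') ≤ Valued.v ϖ ^ (ρ + 2 * t') → g = g' :=
    fun g hg g' hg' h => hR3 g ((hmemR g).1 hg) g' ((hmemR g').1 hg') h
  choose V₀ hV₀ using fun g : K => exists_gl_coe_eq_glued (1 : K) 1 g (pow_ne_zero ρ hϖ0) (pow_ne_zero (2 * ρ + 2 * t') hϖ0)
  have hTr := trace_bound_of_isRamifiedQuadraticDatum hD h2
  -- the shell predicate is invariant under the unit torus
  have hP : ∀ u ∈ unitTorus K 3, ∀ M : Submodule 𝒪[K] (Fin 3 → K),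
      (LatticeInLevel ϖ (d % 2) (Matrix.diagonal ![α - 1, β - 1, 0]) (mapGL (diagGLUnits u) M) ∧
          ¬ LatticeInLevel ϖ (d % 2 + 1) (Matrix.diagonal ![α - 1, β - 1, 0]) (mapGL (diagGLUnits u) M) ∧
          LatticeInLevel ϖ (mcOfRecord d) (Matrix.diagonal ![(α - 1) * (α - 1), (β - 1) * (β - 1), 0]) (mapGL (diagGLUnits u) M)) ↔
        (LatticeInLevel ϖ (d % 2) (Matrix.diagonal ![α - 1, β - 1, 0]) M ∧ ¬ LatticeInLevel ϖ (d % 2 + 1) (Matrix.diagonal ![α - 1, β - 1, 0]) M ∧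
          LatticeInLevel ϖ (mcOfRecord d) (Matrix.diagonal ![(α - 1) * (α - 1), (β - 1) * (β - 1), 0]) M) := by
    intro u _ M
    rw [latticeInLevel_diagonal_mapGL_iff (coe_diagGLUnits u), latticeInLevel_diagonal_mapGL_iff (coe_diagGLUnits u),
      latticeInLevel_diagonal_mapGL_iff (coe_diagGLUnits u)]
  have hdec := finsum_labelledOdd_div_relIndex_glued_sep_eq hσ hvσ hϖ hTr T hT ρ t' hρ ht'1 R hR1' hR2' hR3' V₀ hV₀ 0 i
    (isTorusEquivariantLabel_valueClassLabel σ ϖ (α - 1) (β - 1) (mstarOfRecord d) d)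
    (fun M => LatticeInLevel ϖ (d % 2) (Matrix.diagonal ![α - 1, β - 1, 0]) M ∧ ¬ LatticeInLevel ϖ (d % 2 + 1) (Matrix.diagonal ![α - 1, β - 1, 0]) M ∧
      LatticeInLevel ϖ (mcOfRecord d) (Matrix.diagonal ![(α - 1) * (α - 1), (β - 1) * (β - 1), 0]) M) hP
  beta_reduce at hdec
  rw [stratum_G1_eq hvσ hfix hϖ T hρ hs, hdec]
  refine mul_eq_zero_of_right _ ?_
  -- THE SHARP TOKENS `g_α`, `g_β` AND THE CENTRE `c₀ = g_β ∕ g_α`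
  obtain ⟨-, gα, -, -, hσgα, -, hvgα, hαtok⟩ := exists_towerSign_prec_abs_of_le hD hE.1 hα hpar (by unfold mstarOfRecord; omega)
  obtain ⟨-, gβ, -, -, hσgβ, -, hvgβ, hβtok⟩ := exists_towerSign_prec_abs_of_le hD hE.2.1 hβ (by omega) (by unfold mstarOfRecord; omega)
  have hgα0 : gα ≠ 0 := fun h => by rw [h, map_zero] at hvgα; exact pow_ne_zero _ hvϖ hvgα.symm
  have hc₀ : Valued.v (gβ / gα) = Valued.v ϖ ^ (2 * t') := by
    rw [map_div₀, hvgα, hvgβ, div_eq_iff (pow_ne_zero _ hvϖ), ← pow_add]; congr 1; omega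
  have hσc₀ : σ (gβ / gα) = gβ / gα := by rw [map_div₀, hσgα, hσgβ]
  have hnear : Valued.v (gβ / gα - (β - 1) / (α - 1)) ≤ Valued.v ϖ ^ (2 * t' + E + 1) :=
    v_div_sub_div_le hϖ hα hvgα hvgβ hαtok hβtok (by omega) (by omega)
  -- THE FILTER IS THE `g`-SHELL `|g + c₀| = |ϖ|^{2t′+E}` (instance-agnostic swap of the filter predicate)
  have hswap : ∀ {p : K → Prop} (ip : DecidablePred p) {q : K → Prop} (iq : DecidablePred q) (F : K → ℚ),
      (∀ g ∈ R, (p g ↔ q g)) → ∑ g ∈ @Finset.filter K p ip R, F g = ∑ g ∈ @Finset.filter K q iq R, F g :=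
    by intro p ip q iq F h; exact Finset.sum_congr (@Finset.filter_congr K p q ip iq R h) fun _ _ => rfl
  rw [hswap _ (inferInstance : DecidablePred fun g : K => Valued.v (g + gβ / gα) = Valued.v ϖ ^ (2 * t' + E)) _
    (fun g hg => stable_and_shell_latt_glued_rep_iff_of_near hD h2d hE T hT ρ t' ht'1 hfoot hEdef hhi hnear (hR1' g hg).2 (V₀ g) (hV₀ g))]
  -- THE NORM-CLASS SYSTEMS `Aβ`, `Aγ`
  obtain ⟨⟨hMk, hkM, hdM, hMk2⟩, ⟨hMk', hkM', hdM', hMk2'⟩⟩ := F0P3cDyRamGlueResidueSystems.mod_arith_of_record ρ t' d (by omega)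
  obtain ⟨Aβ, hAβsub, hAβ⟩ := exists_normClass_system hD (n := ρ + 2 * t') (by omega) hMk hkM hdM hMk2 (by omega)
  obtain ⟨Aγ, hAγsub, hAγ⟩ := exists_normClass_system hD (n := 2 * ρ) (by omega) hMk' hkM' hdM' hMk2' (by omega)
  -- THE CONSTANT WEIGHT
  set w : ℚ := ((((Nat.card 𝓀[K] - 1) * Nat.card 𝓀[K] ^ ((ρ + 2 * t' + 1) / 2 - 1)) * ((Nat.card 𝓀[K] - 1) * Nat.card 𝓀[K] ^ (ρ - 1)) : ℕ) : ℚ)⁻¹ with hw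
  -- THE SLOT CLASS-FUNCTION `G_i`
  set G : K → ℤ := fun r => (![normSign σ (r * (r + gβ / gα)), normSign σ (r + gβ / gα),
    normSign σ (-1) * normSign σ ((1 + r) * (r + gβ / gα))] : Fin 3 → ℤ) i with hG
  -- PER REPRESENTATIVE ON THE CUT
  have hper : ∀ g ∈ R.filter (fun g => Valued.v (g + gβ / gα) = Valued.v ϖ ^ (2 * t' + E)),
      (labelledOddCount σ ϖ 0 i (valueClassLabel σ ϖ (α - 1) (β - 1) (mstarOfRecord d) d) (latt (V₀ g : Matrix (Fin 3) (Fin 3) K)) : ℚ) /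
          ((((unitStabilizer (latt (V₀ g : Matrix (Fin 3) (Fin 3) K))).map (unitNormMap σ 3)).relIndex (fixedUnitTorus σ 3) : ℕ) : ℚ) =
        w / (2 * (Aβ.card : ℚ) * (Aγ.card : ℚ)) * ((Aγ.card : ℚ) * (normSign σ gα : ℚ)) * ((∑ aβ ∈ Aβ, G (g + (1 + g) * (aβ - 1)) : ℤ) : ℚ) := by
    intro g hg
    rw [Finset.mem_filter] at hg
    obtain ⟨hgR, hcut⟩ := hg
    obtain ⟨hσg, hvg⟩ := hR1' g hgR
    have hvg1 : Valued.v g < 1 := by rw [hvg]; exact pow_lt_one₀ zero_le hϖ1 (by omega)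
    obtain ⟨hTM, hlev, hnlev, hsq⟩ := (stable_and_shell_latt_glued_rep_iff_of_near hD h2d hE T hT ρ t' ht'1 hfoot hEdef hhi hnear hvg (V₀ g) (hV₀ g)).2 hcut
    -- the tokens in ★ p861678's currency
    have hP : Valued.v ((ϖ * σ ϖ) ^ (ρ + t')) = Valued.v ϖ ^ (2 * ρ + 2 * t') := by rw [v_mul_map_pow hvσ]; congr 1; omega
    have hgα : Valued.v ((ϖ ^ (d % 2 + 2 * d - 1))⁻¹ * (((ϖ * σ ϖ) ^ (ρ + t'))⁻¹ * g *
        ((α - 1) - gα * ((ϖ - σ ϖ) * ((ϖ * σ ϖ) ^ ((d - d % 2) / 2))⁻¹)))) ≤ 1 := by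
      rw [map_mul, map_inv₀, map_mul, map_mul, map_inv₀, map_pow, hP, hvg, mul_assoc,
        inv_mul_le_iff₀ (pow_pos ((Valuation.pos_iff _).2 hϖ0) _), inv_mul_le_iff₀ (pow_pos ((Valuation.pos_iff _).2 hϖ0) _), mul_one]
      calc Valued.v ϖ ^ (2 * t') * Valued.v ((α - 1) - gα * ((ϖ - σ ϖ) * ((ϖ * σ ϖ) ^ ((d - d % 2) / 2))⁻¹))
          ≤ Valued.v ϖ ^ (2 * t') * Valued.v ϖ ^ ((n₂ + d % 2 + 1 - d) + (n₂ - d % 2)) := by gcongr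
        _ = Valued.v ϖ ^ (2 * t' + ((n₂ + d % 2 + 1 - d) + (n₂ - d % 2))) := (pow_add _ _ _).symm
        _ ≤ Valued.v ϖ ^ (2 * ρ + 2 * t' + (d % 2 + 2 * d - 1)) := (hpw _ _).2 (by omega)
        _ = Valued.v ϖ ^ (2 * ρ + 2 * t') * Valued.v ϖ ^ (d % 2 + 2 * d - 1) := pow_add _ _ _
    have hgβ : Valued.v ((ϖ ^ (d % 2 + 2 * d - 1))⁻¹ * (((ϖ * σ ϖ) ^ (ρ + t'))⁻¹ *
        ((β - 1) - gβ * ((ϖ - σ ϖ) * ((ϖ * σ ϖ) ^ ((d - d % 2) / 2))⁻¹)))) ≤ 1 := by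
      rw [map_mul, map_inv₀, map_mul, map_inv₀, map_pow, hP,
        inv_mul_le_iff₀ (pow_pos ((Valuation.pos_iff _).2 hϖ0) _), inv_mul_le_iff₀ (pow_pos ((Valuation.pos_iff _).2 hϖ0) _), mul_one]
      calc Valued.v ((β - 1) - gβ * ((ϖ - σ ϖ) * ((ϖ * σ ϖ) ^ ((d - d % 2) / 2))⁻¹))
          ≤ Valued.v ϖ ^ ((n₂ + 2 * t' + d % 2 + 1 - d) + (n₂ + 2 * t' - d % 2)) := hβtok
        _ ≤ Valued.v ϖ ^ (2 * ρ + 2 * t' + (d % 2 + 2 * d - 1)) := (hpw _ _).2 (by omega)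
        _ = Valued.v ϖ ^ (2 * ρ + 2 * t') * Valued.v ϖ ^ (d % 2 + 2 * d - 1) := pow_add _ _ _
    -- the per-summand identity and the non-vanishing
    have hsgn := fun (aβ : K) (haβ : aβ ∈ Aβ) (aγ : K) (haγ : aγ ∈ Aγ) =>
      classSign_mul_labelSign_eq hD ht'1 hEρ hdeep hσg hvg hσgα hσgβ hgα0 hc₀ hcut (hAβsub aβ haβ).1 (hAβsub aβ haβ).2 (hAγsub aγ haγ).1 (hAγsub aγ haγ).2 i
    have hL : ∀ aβ ∈ Aβ, ∀ aγ ∈ Aγ, g * gα + aγ * (aβ + g⁻¹ * (aβ - 1))⁻¹ * gβ ≠ 0 := fun aβ haβ aγ haγ => (hsgn aβ haβ aγ haγ).1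
    have hn : IsNormalisedLattice (latt (V₀ g : Matrix (Fin 3) (Fin 3) K)) := by
      rw [hV₀ g]; exact isNormalisedLattice_latt_glued_rep hϖ1.le ρ t' hvg1
    have hhead := labelledOddCount_div_relIndex_glued_rep_eq hD hρ ht'1 hσg hvg (V₀ g) (hV₀ g) hn hE
      (mc := mcOfRecord d) (by omega) (by omega) (by omega) (by omega) hlev hnlev hsq hT hTM hσgα hσgβ hgα hgβ Aβ Aγ hAγsub hAγ hAβsub hAβ hL i
    have hwg : stabiliserWeight σ (latt (V₀ g : Matrix (Fin 3) (Fin 3) K)) = w := by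
      rw [hw]
      exact stabiliserWeight_latt_glued_eq hσ hvσ hfix hϖ hd hρ (2 * t') (x := 1) (ζ := 1) (y'' := g) (by rw [map_one]) (by rw [map_one]) hvg (V₀ g) (hV₀ g)
        hσg (by rw [hσg, map_one, one_mul, sub_self, map_zero]; exact zero_le)
    have hint : normSign σ ((![((ϖ * σ ϖ) ^ (ρ + t'))⁻¹ * g, ((ϖ * σ ϖ) ^ (ρ + t'))⁻¹, -(((ϖ * σ ϖ) ^ (ρ + t'))⁻¹ * (1 + g)⁻¹)] : Fin 3 → K) i) *
        (∑ aβ ∈ Aβ, ∑ aγ ∈ Aγ, normSign σ ((![(1 : K), aγ * (aβ + g⁻¹ * (aβ - 1))⁻¹, aγ * (aβ + g⁻¹ * (aβ - 1))⁻¹ * aβ] : Fin 3 → K) i) *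
          normSign σ (g * gα + aγ * (aβ + g⁻¹ * (aβ - 1))⁻¹ * gβ)) =
        (Aγ.card : ℤ) * normSign σ gα * ∑ aβ ∈ Aβ, G (g + (1 + g) * (aβ - 1)) := by
      rw [Finset.mul_sum, Finset.mul_sum]
      refine Finset.sum_congr rfl fun aβ haβ => ?_
      rw [Finset.mul_sum, Finset.sum_congr rfl fun aγ haγ => (hsgn aβ haβ aγ haγ).2, Finset.sum_const, nsmul_eq_mul]
      simp only [hG]
      ring
    rw [show mstarOfRecord d = d % 2 + 2 * d - 1 from rfl, hhead, hwg, mul_div_assoc, mul_comm (normSign σ _ : ℚ) (w / _), mul_assoc, mul_assoc, ← Int.cast_mul, hint]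
    push_cast
    ring
  rw [Finset.sum_congr rfl hper, ← Finset.mul_sum, ← Int.cast_sum]
  -- THE WINDOW SUMS VANISH (LH7-p07 (g0), ★ p861670)
  suffices hzero : ∑ g ∈ R.filter (fun g => Valued.v (g + gβ / gα) = Valued.v ϖ ^ (2 * t' + E)), ∑ aβ ∈ Aβ, G (g + (1 + g) * (aβ - 1)) = 0 by
    rw [hzero, Int.cast_zero, mul_zero]
  have h0 := sum_filter_sum_normSign_mul_add_eq_zero hD h2 h2d (s := 2 * t') (n := ρ + 2 * t') (k := 2 * ρ + 2 * t') (M := ρ + t' + d / 2) (e := 2 * t' + E)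
    (by omega) (by omega) (by omega) (by omega) (by omega) (by omega) hMk hkM hdM hMk2 hσc₀ hc₀ R hR1' hR2' hR3' Aβ hAβsub hAβ
  have h1 := sum_filter_sum_normSign_add_eq_zero hD h2 h2d (s := 2 * t') (n := ρ + 2 * t') (k := 2 * ρ + 2 * t') (M := ρ + t' + d / 2) (e := 2 * t' + E)
    (by omega) (by omega) (by omega) (by omega) (by omega) (by omega) hMk hkM hdM hMk2 hσc₀ hc₀ R hR1' hR2' hR3' Aβ hAβsub hAβ
  have h2' := sum_filter_sum_normSign_one_add_mul_add_eq_zero hD h2 h2d (s := 2 * t') (n := ρ + 2 * t') (k := 2 * ρ + 2 * t') (M := ρ + t' + d / 2) (e := 2 * t' + E)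
    (by omega) (by omega) (by omega) (by omega) (by omega) (by omega) hMk hkM hdM hMk2 hσc₀ hc₀ R hR1' hR2' hR3' Aβ hAβsub hAβ
  fin_cases i
  · simp only [hG, Fin.zero_eta, Fin.isValue, Matrix.cons_val_zero]
    convert h0 using 2
  · simp only [hG, Fin.mk_one, Fin.isValue, Matrix.cons_val_one, Matrix.cons_val_zero]
    convert h1 using 2
  · simp only [hG, Fin.reduceFinMk, Matrix.cons_val_two, Matrix.tail_cons, Matrix.head_cons]
    rw [show ∑ g ∈ R.filter (fun g => Valued.v (g + gβ / gα) = Valued.v ϖ ^ (2 * t' + E)), ∑ aβ ∈ Aβ,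
        normSign σ (-1) * normSign σ ((1 + (g + (1 + g) * (aβ - 1))) * ((g + (1 + g) * (aβ - 1)) + gβ / gα)) =
      normSign σ (-1) * ∑ g ∈ R.filter (fun g => Valued.v (g + gβ / gα) = Valued.v ϖ ^ (2 * t' + E)), ∑ aβ ∈ Aβ,
        normSign σ ((1 + (g + (1 + g) * (aβ - 1))) * ((g + (1 + g) * (aβ - 1)) + gβ / gα)) by
      rw [Finset.mul_sum]; exact Finset.sum_congr rfl fun _ _ => by rw [Finset.mul_sum]]
    rw [mul_eq_zero]; right
    convert h2' using 2

end Summit.HodgeConjecture.HodgeConjecture.Cruxes.H413.F0P3cDyRamLabelledOddGlueWindow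

end
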